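import Literature.NumberTheory.Automorphic.ChevalleyVerma
import Literature.NumberTheory.Automorphic.RootDatumWeights
import HarnessLib

/-!
# Weights of the Verma module of a Chevalley system; the maximal submodule

Trunk T-AUTOMORPHIC (G25 AutomorphicL); highest-weight theory for Chevalley's existence theorem
(`Literature.NumberTheory.Automorphic.chevalley_existence`, Springer 10.1.1), step 2 after
`ChevalleyVerma.lean` (the Verma module `M(λ) = Verma S lam` of a Chevalley system `S` with its
PBW basis `vermaBasis S lam` indexed by multi-indices `n` on the negative roots):

* `DiagSep` — a general lemma on **weight components of subspaces stable under a separating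
  family of diagonal operators** (`DiagSep.proj_mem`: the Vandermonde / interpolation trick with
  `T = ∏ (T_s - d_s 1)`, Humphreys §20.2), and the coordinates of simultaneous eigenvectors
  (`DiagSep.repr_eq_zero_of_eigen`);
* the `X`-degree `rootSum n = ∑ n_β β` of a multi-index, characters `xChar x = (⟨x, α_s^∨⟩)_s`
  and their separation of degrees in characteristic `0` (`eq_of_xChar_eq`, Cartan matrix
  non-degenerate: `RootDatumWeights.eq_of_sub_mem_rootSpan`), `rootSum n = 0 ↔ n = 0`;
* **`h_s v_n = (λ_s + ⟨rootSum n, α_s^∨⟩) v_n`** (`lie_h_vermaVec`, from the commutation of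
  `ι(h_s)` past PBW words, `ιh_mul_word`);
* the weight spaces `wsp S lam x = span {v_n | rootSum n = x}` (**`h_s` acts by the scalar
  `λ_s + ⟨x, α_s^∨⟩`**, `lie_h_of_mem_wsp`; simultaneous eigenvectors lie in weight spaces,
  `mem_wsp_of_lie_h_eq`; **`e_α M(λ)_x ⊆ M(λ)_{x+α}`**, `lie_e_mem_wsp`);
* **the maximal submodule** `maxSub S lam = {v | every U(L)-translate of v has zero
  v_λ-coordinate}` (`hwCoord`): it misses `v_λ` and **contains every `U(L)`-submodule missing
  `v_λ`** (`le_maxSub_of_hwv_notMem`, by `DiagSep.proj_mem` for the `h_s`), so every submodule is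
  `⊤` or `≤ maxSub` (`eq_top_or_le_maxSub`, `isCoatom_maxSub`; Humphreys §20.2 Theorem (e)).

Everything is proved; statements are [folklore] (Humphreys, *Introduction to Lie Algebras*,
§20.2; Dixmier, *Enveloping Algebras*, 7.1). Mathlib has no Verma modules; the generic lemma
`DiagSep.proj_mem` is the infinite-dimensional, multi-operator form of Mathlib's
`Submodule.inf_iSup_genEigenspace` (one operator, finite dimension) and is not in Mathlib.
-/

noncomputable section

open Set Function Finsupp UniversalEnvelopingAlgebra
open Literature.Algebra.Lie.PBW

attribute [local instance 100] LieRing.ofAssociativeRing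

namespace Literature.NumberTheory.Automorphic

/-! ### Diagonal operators on a basis: weight components of stable subspaces -/

namespace DiagSep

variable {k : Type*} [Field k] {M : Type*} [AddCommGroup M] [Module k M] {idx : Type*}
  (B : Module.Basis idx k M)

/-- **Coordinates of `D v` for an operator `D` acting diagonally on the basis `B`.** [folklore] -/
theorem repr_apply_of_diag {D : M →ₗ[k] M} {d : idx → k} (hD : ∀ i, D (B i) = d i • B i)
    (v : M) (i : idx) : B.repr (D v) i = d i * B.repr v i := by
  classical
  have key : (B.coord i).comp D = d i • B.coord i := by
    refine B.ext fun j => ?_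
    simp only [LinearMap.comp_apply, hD, map_smul, Module.Basis.coord_apply, Module.Basis.repr_self,
      LinearMap.smul_apply, smul_eq_mul, Finsupp.single_apply]
    split_ifs with h
    · subst h; ring
    · ring
  simpa [Module.Basis.coord_apply] using LinearMap.congr_fun key v

/-- A product (of a list) of operators acting diagonally on `B` acts diagonally, with the product
of the eigenvalues. [folklore] -/
theorem listProd_apply_basis (l : List (M →ₗ[k] M)) (d : (M →ₗ[k] M) → idx → k)
    (hl : ∀ D ∈ l, ∀ i, D (B i) = d D i • B i) (i : idx) :
    l.prod (B i) = (l.map fun D => d D i).prod • B i := by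
  induction l with
  | nil => simp
  | cons D l ih =>
    rw [List.prod_cons, Module.End.mul_apply, ih (fun D' hD' => hl D' (List.mem_cons_of_mem _ hD')),
      map_smul, hl D List.mem_cons_self, smul_smul, List.map_cons, List.prod_cons, mul_comm]

/-- A product (of a list) of operators preserving a subspace preserves it. [folklore] -/
theorem listProd_apply_mem (l : List (M →ₗ[k] M)) (W : Submodule k M)
    (hl : ∀ D ∈ l, ∀ v ∈ W, D v ∈ W) {v : M} (hv : v ∈ W) : l.prod v ∈ W := by
  induction l with
  | nil => simpa using hv
  | cons D l ih =>
    rw [List.prod_cons, Module.End.mul_apply]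
    exact hl D List.mem_cons_self _ (ih fun D' hD' => hl D' (List.mem_cons_of_mem _ hD'))

variable {Ω : Type*} (w : idx → Ω)

open scoped Classical in
/-- **The weight-`ω` component** of `v` for the weight function `w` on the basis: the part of the
expansion of `v` along the basis vectors of weight `ω`. [folklore] -/
def proj (ω : Ω) (v : M) : M := B.repr.symm ((B.repr v).filter fun i => w i = ω)

open scoped Classical in
/-- Coordinates of the weight component. [folklore] -/
lemma repr_proj (ω : Ω) (v : M) : B.repr (proj B w ω v) = (B.repr v).filter fun i => w i = ω := by
  simp [proj]

/-- Coordinates of the weight component at an index of that weight. [folklore] -/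
lemma repr_proj_apply_of_eq {ω : Ω} (v : M) {i : idx} (h : w i = ω) :
    B.repr (proj B w ω v) i = B.repr v i := by
  classical
  rw [repr_proj, Finsupp.filter_apply, if_pos h]

/-- Coordinates of the weight component at an index of another weight. [folklore] -/
lemma repr_proj_apply_of_ne {ω : Ω} (v : M) {i : idx} (h : w i ≠ ω) :
    B.repr (proj B w ω v) i = 0 := by
  classical
  rw [repr_proj, Finsupp.filter_apply, if_neg h]

/-- `proj` is linear. [folklore] -/
lemma proj_add (ω : Ω) (v v' : M) : proj B w ω (v + v') = proj B w ω v + proj B w ω v' := by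
  classical
  apply B.repr.injective
  rw [map_add, repr_proj, repr_proj, repr_proj, map_add, Finsupp.filter_add]

/-- `proj` is homogeneous. [folklore] -/
lemma proj_smul (ω : Ω) (c : k) (v : M) : proj B w ω (c • v) = c • proj B w ω v := by
  classical
  apply B.repr.injective
  rw [map_smul, repr_proj, repr_proj, map_smul, Finsupp.filter_smul]

/-- The weight component of a basis vector of that weight is itself. [folklore] -/
lemma proj_basis_of_eq {ω : Ω} {i : idx} (h : w i = ω) : proj B w ω (B i) = B i := by
  classical
  apply B.repr.injective
  ext j
  by_cases hj : w j = ω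
  · rw [repr_proj_apply_of_eq B w _ hj]
  · rw [repr_proj_apply_of_ne B w _ hj, Module.Basis.repr_self, Finsupp.single_apply, if_neg]
    rintro rfl
    exact hj h

/-- The weight component of a basis vector of another weight vanishes. [folklore] -/
lemma proj_basis_of_ne {ω : Ω} {i : idx} (h : w i ≠ ω) : proj B w ω (B i) = 0 := by
  classical
  apply B.repr.injective
  ext j
  rw [map_zero, Finsupp.zero_apply]
  by_cases hj : w j = ω
  · rw [repr_proj_apply_of_eq B w _ hj, Module.Basis.repr_self, Finsupp.single_apply, if_neg]
    rintro rfl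
    exact h hj
  · rw [repr_proj_apply_of_ne B w _ hj]

/-- A vector all of whose coordinates have weight `ω` is its own weight-`ω` component. [folklore] -/
lemma proj_eq_self {ω : Ω} {v : M} (h : ∀ i ∈ (B.repr v).support, w i = ω) : proj B w ω v = v := by
  classical
  apply B.repr.injective
  ext j
  by_cases hj : w j = ω
  · rw [repr_proj_apply_of_eq B w _ hj]
  · rw [repr_proj_apply_of_ne B w _ hj, eq_comm]
    by_contra hne
    exact hj (h j (Finsupp.mem_support_iff.2 hne))

/-- A vector none of whose coordinates has weight `ω` has zero weight-`ω` component. [folklore] -/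
lemma proj_eq_zero {ω : Ω} {v : M} (h : ∀ i ∈ (B.repr v).support, w i ≠ ω) : proj B w ω v = 0 := by
  classical
  apply B.repr.injective
  ext j
  rw [map_zero, Finsupp.zero_apply]
  by_cases hj : w j = ω
  · rw [repr_proj_apply_of_eq B w _ hj]
    by_contra hne
    exact h j (Finsupp.mem_support_iff.2 hne) hj
  · rw [repr_proj_apply_of_ne B w _ hj]

/-- **A vector is the (finite) sum of its weight components.** [folklore] -/
theorem sum_proj [DecidableEq Ω] (v : M) :
    ∑ ω ∈ (B.repr v).support.image w, proj B w ω v = v := by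
  classical
  apply B.repr.injective
  ext j
  rw [map_sum, Finsupp.finsetSum_apply]
  by_cases hj : j ∈ (B.repr v).support
  · rw [Finset.sum_eq_single_of_mem (w j) (Finset.mem_image_of_mem w hj)]
    · exact repr_proj_apply_of_eq B w v rfl
    · intro ω _ hne
      exact repr_proj_apply_of_ne B w v (Ne.symm hne)
  · rw [Finsupp.notMem_support_iff.1 hj]
    refine Finset.sum_eq_zero fun ω _ => ?_
    by_cases hω : w j = ω
    · rw [repr_proj_apply_of_eq B w v hω, Finsupp.notMem_support_iff.1 hj]
    · exact repr_proj_apply_of_ne B w v hω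

/-- **Weight components of stable subspaces.** Let operators `T s` act diagonally on the
basis `B` with eigenvalue `d s (w i)` on `B i` depending only on the weight, and separate the
weights occurring (`w i ≠ w j ⇒ ∃ s, d s (w i) ≠ d s (w j)`). Then every `k`-subspace `W`
stable under the `T s` contains the weight components of its elements: with
`T = ∏_{ω' ≠ ω} (T_{s(ω')} - d_{s(ω')} ω')` over the other weights `ω'` occurring in `v`,
`T v = c · proj_ω v` with `c ≠ 0` (the Vandermonde / interpolation argument, Humphreys §20.2,
step (2) of the proof of Theorem 20.2). [folklore] -/
theorem proj_mem {σ : Type*} (T : σ → M →ₗ[k] M) (d : σ → Ω → k)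
    (hdiag : ∀ s i, T s (B i) = d s (w i) • B i)
    (hsep : ∀ i j, w i ≠ w j → ∃ s, d s (w i) ≠ d s (w j))
    (W : Submodule k M) (hW : ∀ s, ∀ v ∈ W, T s v ∈ W) {v : M} (hv : v ∈ W) (ω : Ω) :
    proj B w ω v ∈ W := by
  classical
  -- if no coordinate of `v` has weight `ω`, the component is `0`
  by_cases hex : ∃ i₀ ∈ (B.repr v).support, w i₀ = ω
  swap
  · push Not at hex
    rw [proj_eq_zero B w hex]
    exact W.zero_mem
  obtain ⟨i₀, hi₀, rfl⟩ := hex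
  -- the other weights occurring in `v`, and separating operators
  set F : Finset Ω := ((B.repr v).support.image w).erase (w i₀) with hF
  have hFsep : ∀ ω' ∈ F, ∃ s, d s (w i₀) ≠ d s ω' := by
    intro ω' hω'
    obtain ⟨hne, hmem⟩ := Finset.mem_erase.1 hω'
    obtain ⟨j, -, rfl⟩ := Finset.mem_image.1 hmem
    exact hsep i₀ j (Ne.symm hne)
  -- if all coordinates of `v` have weight `w i₀`, the component is `v` itself
  by_cases hFe : F = ∅
  · have hself : proj B w (w i₀) v = v := proj_eq_self B w fun j hj => by
      by_contra hne
      have hjF : w j ∈ F := Finset.mem_erase.2 ⟨hne, Finset.mem_image_of_mem w hj⟩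
      rw [hFe] at hjF
      exact absurd hjF (Finset.notMem_empty _)
    rw [hself]
    exact hv
  obtain ⟨ω₁, hω₁⟩ := Finset.nonempty_iff_ne_empty.2 hFe
  obtain ⟨s₁, -⟩ := hFsep ω₁ hω₁
  haveI : Nonempty σ := ⟨s₁⟩
  choose! sep hsepF using hFsep
  set l : List (M →ₗ[k] M) :=
    F.toList.map fun ω' => T (sep ω') - algebraMap k (M →ₗ[k] M) (d (sep ω') ω') with hl
  have hfac : ∀ ω' i, (T (sep ω') - algebraMap k (M →ₗ[k] M) (d (sep ω') ω')) (B i) =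
      (d (sep ω') (w i) - d (sep ω') ω') • B i := by
    intro ω' i
    rw [LinearMap.sub_apply, hdiag, Module.algebraMap_end_apply, sub_smul]
  -- `l.prod (B i) = c i • B i`
  have hprod : ∀ (L : List Ω) (i : idx),
      (L.map fun ω' => T (sep ω') - algebraMap k (M →ₗ[k] M) (d (sep ω') ω')).prod (B i) =
        (L.map fun ω' => d (sep ω') (w i) - d (sep ω') ω').prod • B i := by
    intro L i
    induction L with
    | nil => simp
    | cons ω' L ih =>
      rw [List.map_cons, List.prod_cons, Module.End.mul_apply, ih, map_smul, hfac, smul_smul,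
        List.map_cons, List.prod_cons, mul_comm]
  set c : idx → k := fun i => (F.toList.map fun ω' => d (sep ω') (w i) - d (sep ω') ω').prod
    with hc
  have hTB : ∀ i, l.prod (B i) = c i • B i := fun i => hprod F.toList i
  -- `c i = 0` when `w i ∈ F`, and `c i₀ ≠ 0`
  have hc0 : ∀ i, w i ∈ F → c i = 0 := by
    intro i hi
    apply List.prod_eq_zero
    exact List.mem_map.2 ⟨w i, Finset.mem_toList.2 hi, sub_self _⟩
  have hc1 : c i₀ ≠ 0 := by
    apply List.prod_ne_zero
    intro h0
    obtain ⟨ω', hω', h0'⟩ := List.mem_map.1 h0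
    exact hsepF ω' (Finset.mem_toList.1 hω') (sub_eq_zero.1 h0')
  have hcω : ∀ i, w i = w i₀ → c i = c i₀ := by
    intro i hi
    simp only [hc, hi]
  -- `T v ∈ W`
  have hTv : l.prod v ∈ W := by
    refine listProd_apply_mem l W (fun D hD u hu => ?_) hv
    obtain ⟨ω', -, rfl⟩ := List.mem_map.1 hD
    rw [LinearMap.sub_apply, Module.algebraMap_end_apply]
    exact W.sub_mem (hW _ u hu) (W.smul_mem _ hu)
  -- `T v = c i₀ • proj v`
  have hTeq : l.prod v = c i₀ • proj B w (w i₀) v := by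
    apply B.repr.injective
    ext j
    rw [repr_apply_of_diag B hTB v j, map_smul, Finsupp.smul_apply, smul_eq_mul]
    by_cases hj : w j = w i₀
    · rw [repr_proj_apply_of_eq B w v hj, hcω j hj]
    · rw [repr_proj_apply_of_ne B w v hj, mul_zero]
      by_cases hjs : j ∈ (B.repr v).support
      · rw [hc0 j (Finset.mem_erase.2 ⟨hj, Finset.mem_image_of_mem w hjs⟩), zero_mul]
      · rw [Finsupp.notMem_support_iff.1 hjs, mul_zero]
  have : proj B w (w i₀) v = (c i₀)⁻¹ • l.prod v := by
    rw [hTeq, smul_smul, inv_mul_cancel₀ hc1, one_smul]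
  rw [this]
  exact W.smul_mem _ hTv

/-- **Coordinates of a simultaneous eigenvector**: if `T s v = χ s • v` for all `s`, then the
coordinates of `v` along basis vectors whose eigenvalues differ from `χ` vanish. [folklore] -/
theorem repr_eq_zero_of_eigen {σ : Type*} (T : σ → M →ₗ[k] M) (d : σ → Ω → k)
    (hdiag : ∀ s i, T s (B i) = d s (w i) • B i) {v : M} {χ : σ → k}
    (hv : ∀ s, T s v = χ s • v) {i : idx} (hi : (fun s => d s (w i)) ≠ χ) : B.repr v i = 0 := by
  by_contra hne
  apply hi
  funext s
  have h1 := repr_apply_of_diag B (hdiag s) v i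
  rw [hv s, map_smul, Finsupp.smul_apply, smul_eq_mul] at h1
  exact (mul_left_injective₀ hne h1).symm

end DiagSep

namespace ChevalleyVerma

variable {k : Type*} [Field k]
variable {ι X Y : Type*} [AddCommGroup X] [AddCommGroup Y] [Fintype ι] [DecidableEq ι]
variable {P : RootPairing ι ℤ X Y} {b : P.Base}

/-! ### The action of `h_s` on PBW vectors -/

/-- The `α_s^∨`-weight of a PBW index: `0` on Cartan indices, `⟨α, α_s^∨⟩` on the root index
`α`. [folklore] -/
def idxWt (s : b.support) : PBWIdx b → k := Sum.elim (fun _ => 0) fun i => (P.pairing i s : k)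

omit [Fintype ι] [DecidableEq ι] in
/-- Weight of a Cartan index. [folklore] -/
@[simp] lemma idxWt_cartan (s t : b.support) : idxWt (k := k) s (PBWIdx.cartan t) = 0 := rfl

omit [Fintype ι] [DecidableEq ι] in
/-- Weight of a root index. [folklore] -/
@[simp] lemma idxWt_root (s : b.support) (i : ι) :
    idxWt (k := k) s (PBWIdx.root i : PBWIdx b) = (P.pairing i s : k) := rfl

/-- The `X`-degree `∑_β n_β β` of a multi-index on the negative roots (so that the PBW vector `v_n`
of `M(λ)` has weight `λ + rootSum n`). [folklore] -/
def rootSum (b : P.Base) (n : NegRoot b →₀ ℕ) : X := n.sum fun i c => c • P.root i.1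

/-- An element `x ∈ X` as a character of the `h_s`: `s ↦ ⟨x, α_s^∨⟩ ∈ ℤ ⊆ k`. [folklore] -/
def xChar (b : P.Base) (k : Type*) [Field k] (x : X) : b.support → k :=
  fun s => ((P.toLinearMap x (P.coroot s) : ℤ) : k)

omit [Fintype ι] [DecidableEq ι] in
/-- Unfolding of `xChar`. [folklore] -/
@[simp] lemma xChar_apply (x : X) (s : b.support) :
    xChar b k x s = ((P.toLinearMap x (P.coroot s) : ℤ) : k) := rfl

omit [Fintype ι] [DecidableEq ι] in
/-- `xChar` is additive. [folklore] -/
lemma xChar_add (x y : X) : xChar b k (x + y) = xChar b k x + xChar b k y := by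
  funext s; simp

omit [Fintype ι] [DecidableEq ι] in
/-- `xChar` of a root: `⟨α_i, α_s^∨⟩`. [folklore] -/
lemma xChar_root (i : ι) (s : b.support) : xChar b k (P.root i) s = (P.pairing i s : k) := by
  rw [xChar_apply, P.root_coroot_eq_pairing]

omit [Fintype ι] [DecidableEq ι] in
/-- `rootSum 0 = 0`. [folklore] -/
@[simp] lemma rootSum_zero : rootSum b (0 : NegRoot b →₀ ℕ) = 0 := by simp [rootSum]

omit [Fintype ι] [DecidableEq ι] in
/-- `rootSum` is additive. [folklore] -/
lemma rootSum_add (n n' : NegRoot b →₀ ℕ) : rootSum b (n + n') = rootSum b n + rootSum b n' :=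
  Finsupp.sum_add_index' (fun _ => zero_smul _ _) (fun _ _ _ => add_smul _ _ _)

omit [Fintype ι] [DecidableEq ι] in
/-- `rootSum (single i c) = c • β_i`. [folklore] -/
@[simp] lemma rootSum_single (i : NegRoot b) (c : ℕ) :
    rootSum b (Finsupp.single i c) = c • P.root i.1 :=
  Finsupp.sum_single_index (zero_smul _ _)

omit [Fintype ι] [DecidableEq ι] in
/-- `rootSum n` lies in the root lattice. [folklore] -/
lemma rootSum_mem_rootSpan (n : NegRoot b →₀ ℕ) : rootSum b n ∈ P.rootSpan ℤ := by
  unfold rootSum Finsupp.sum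
  refine Submodule.sum_mem _ fun i _ => ?_
  dsimp only
  rw [← Nat.cast_smul_eq_nsmul ℤ]
  exact Submodule.smul_mem _ _ (Submodule.subset_span (mem_range_self _))

omit [Fintype ι] [DecidableEq ι] in
/-- **The character of `rootSum n`**: `⟨rootSum n, α_s^∨⟩ = ∑ n_β ⟨β, α_s^∨⟩` (in `k`). [folklore] -/
theorem xChar_rootSum (n : NegRoot b →₀ ℕ) (s : b.support) :
    xChar b k (rootSum b n) s = n.sum fun i c => c • (P.pairing i.1 s : k) := by
  simp only [xChar_apply, rootSum]
  unfold Finsupp.sum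
  rw [map_sum, LinearMap.sum_apply, Int.cast_sum]
  refine Finset.sum_congr rfl fun i _ => ?_
  dsimp only
  rw [map_nsmul, LinearMap.smul_apply, P.root_coroot_eq_pairing, nsmul_eq_mul, Int.cast_mul,
    Int.cast_natCast, nsmul_eq_mul]

omit [DecidableEq ι] in
/-- **`X`-degrees are separated by their characters** (characteristic `0` and non-degeneracy of
the Cartan matrix, `RootDatumWeights.eq_of_sub_mem_rootSpan`): elements of `X` congruent modulo
the root lattice with the same character are equal. [folklore] -/
theorem eq_of_xChar_eq [CharZero k] [Module.Finite ℤ X] {x y : X} (hxy : x - y ∈ P.rootSpan ℤ)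
    (hc : xChar b k x = xChar b k y) : x = y := by
  refine RootDatumWeights.eq_of_sub_mem_rootSpan P b hxy fun s hs => ?_
  have h1 := congr_fun hc ⟨s, hs⟩
  simp only [xChar_apply] at h1
  exact_mod_cast h1

omit [DecidableEq ι] in
/-- `rootSum n = rootSum n'` as soon as their characters agree. [folklore] -/
theorem rootSum_eq_of_xChar_eq [CharZero k] [Module.Finite ℤ X] {n n' : NegRoot b →₀ ℕ}
    (hc : xChar b k (rootSum b n) = xChar b k (rootSum b n')) : rootSum b n = rootSum b n' :=
  eq_of_xChar_eq (Submodule.sub_mem _ (rootSum_mem_rootSpan n) (rootSum_mem_rootSpan n')) hc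

/-- **`rootSum n = 0` only for `n = 0`** (a non-trivial `ℕ`-combination of negative roots is
non-zero, `RootDatumWeights.eq_zero_of_sum_nsmul_root_eq_zero`). [folklore] -/
theorem rootSum_eq_zero_iff [P.IsReduced] {n : NegRoot b →₀ ℕ} : rootSum b n = 0 ↔ n = 0 := by
  refine ⟨fun hn => ?_, fun hn => by rw [hn, rootSum_zero]⟩
  unfold rootSum Finsupp.sum at hn
  have h0 := RootDatumWeights.eq_zero_of_sum_nsmul_root_eq_zero P b n.support (fun i => i.1) n
    (fun i _ => i.2) hn
  ext i
  by_cases hi : i ∈ n.support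
  · exact h0 i hi
  · exact Finsupp.notMem_support_iff.1 hi

/-- The total weight of a multiset as a `Finsupp` sum. [folklore] -/
lemma sum_map_toMultiset {α : Type*} (f : α → k) (m : α →₀ ℕ) :
    ((toMultiset m).map f).sum = m.sum fun a c => c • f a := by
  induction m using Finsupp.induction with
  | zero => simp
  | single_add a c m ha hc ih =>
    rw [map_add, Multiset.map_add, Multiset.sum_add, ih, toMultiset_single, Multiset.map_nsmul,
      Multiset.sum_nsmul, Multiset.map_singleton, Multiset.sum_singleton,
      Finsupp.sum_add_index' (h := fun a c => c • f a) (fun _ => zero_smul _ _)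
        (fun _ _ _ => add_smul _ _ _),
      Finsupp.sum_single_index (h := fun a c => c • f a) (zero_smul _ _)]

omit [DecidableEq ι] in
/-- The eigenvalues of the `h_s` separate the `X`-degrees (characteristic `0`). [folklore] -/
lemma sep_rootSum [CharZero k] [Module.Finite ℤ X] (lam : b.support → k) (n n' : NegRoot b →₀ ℕ)
    (hne : rootSum b n ≠ rootSum b n') :
    ∃ s : b.support, lam s + xChar b k (rootSum b n) s ≠ lam s + xChar b k (rootSum b n') s := by
  by_contra hall
  push Not at hall
  exact hne (rootSum_eq_of_xChar_eq (funext fun s => add_left_cancel (hall s)))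

section System

variable {L : Type*} [LieRing L] [LieAlgebra k L] {h : b.support → L} {e : ι → L}
  (S : IsChevalleySystem P b k h e)

local notation "𝓤" => UniversalEnvelopingAlgebra k L
local notation "ιU" => UniversalEnvelopingAlgebra.ι k (L := L)

include S

omit [Fintype ι] [DecidableEq ι] in
/-- `ι(h_s) ι(x) = ι(x) ι(h_s) + wt(x) ι(x)` for a basis vector `x`. [folklore] -/
lemma ιh_mul_ι_basisPBW (s : b.support) (x : PBWIdx b) :
    ιU (h s) * ιU (basisPBW S x) =
      ιU (basisPBW S x) * ιU (h s) + idxWt (k := k) s x • ιU (basisPBW S x) := by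
  cases x with
  | inl t =>
    change ιU (h s) * ιU (basisPBW S (PBWIdx.cartan t)) =
      ιU (basisPBW S (PBWIdx.cartan t)) * ιU (h s) +
        idxWt (k := k) s (PBWIdx.cartan t) • ιU (basisPBW S (PBWIdx.cartan t))
    rw [basisPBW_cartan, idxWt_cartan, zero_smul, add_zero]
    exact commute_ιh S s t
  | inr i =>
    change ιU (h s) * ιU (basisPBW S (PBWIdx.root i)) =
      ιU (basisPBW S (PBWIdx.root i)) * ιU (h s) +
        idxWt s (PBWIdx.root i : PBWIdx b) • ιU (basisPBW S (PBWIdx.root i))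
    rw [basisPBW_root, idxWt_root]
    exact ιh_mul_ιe S s i

omit [Fintype ι] [DecidableEq ι] in
/-- **`ι(h_s)` acts on a PBW word by its total weight**:
`ι(h_s) w = w ι(h_s) + (∑ wt) w`. [folklore] -/
theorem ιh_mul_word (s : b.support) (l : List (PBWIdx b)) :
    ιU (h s) * word (basisPBW S) l =
      word (basisPBW S) l * ιU (h s) + (l.map (idxWt (k := k) s)).sum • word (basisPBW S) l := by
  induction l with
  | nil => simp
  | cons x l ih =>
    rw [word_cons, ← mul_assoc, ιh_mul_ι_basisPBW S, add_mul, mul_assoc, ih, List.map_cons,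
      List.sum_cons, add_smul, smul_mul_assoc, mul_add, mul_smul_comm, ← mul_assoc]
    abel

omit [Fintype ι] [DecidableEq ι] in
/-- `[u ι(h_s)] = λ_s [u]` in the Verma module. [folklore] -/
lemma mkV_mul_ιh (lam : b.support → k) (s : b.support) (u : 𝓤) :
    mkV S lam (u * ιU (h s)) = lam s • mkV S lam u := by
  have h3 := mkV_mul_gen S lam (ιh_sub_mem_vermaGens S lam s) u
  rw [mul_sub, map_sub, sub_eq_zero] at h3
  rw [h3, ← Algebra.commutes, ← Algebra.smul_def, mkV_smul]

omit [Fintype ι] [DecidableEq ι] in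
/-- **`h_s` acts on the class of a PBW word by `λ_s + ∑ wt`.** [folklore] -/
theorem lie_h_mkV_word (lam : b.support → k) (s : b.support) (l : List (PBWIdx b)) :
    ⁅h s, mkV S lam (word (basisPBW S) l)⁆ =
      (lam s + (l.map (idxWt (k := k) s)).sum) • mkV S lam (word (basisPBW S) l) := by
  rw [lie_mkV, ιh_mul_word S, map_add, mkV_mul_ιh S, mkV_smul, add_smul]

omit [DecidableEq ι] in
/-- **`h_s` acts on the PBW vector `v_n` by the scalar `λ_s + ⟨rootSum n, α_s^∨⟩`.** [folklore] -/
theorem lie_h_vermaVec (lam : b.support → k) (s : b.support) (n : NegRoot b →₀ ℕ) :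
    ⁅h s, vermaVec S lam n⁆ = (lam s + xChar b k (rootSum b n) s) • vermaVec S lam n := by
  rw [vermaVec, ordMonomial, lie_h_mkV_word S, xChar_rootSum]
  congr 2
  rw [← Multiset.sum_coe, ← Multiset.map_coe, Multiset.sort_eq, ← Finsupp.toMultiset_map,
    Multiset.map_map, sum_map_toMultiset]
  rfl

/-! ### The operators `h_s` and `e_α` on `M(λ)` as `k`-linear maps -/

/-- The action of `h_s` on `M(λ)` as a `k`-linear map. [folklore] -/
def lieH (lam : b.support → k) (s : b.support) : Verma S lam →ₗ[k] Verma S lam :=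
  LieModule.toEnd k L (Verma S lam) (h s)

omit [Fintype ι] [DecidableEq ι] in
/-- Unfolding of `lieH`. [folklore] -/
@[simp] lemma lieH_apply (lam : b.support → k) (s : b.support) (v : Verma S lam) :
    lieH S lam s v = ⁅h s, v⁆ := rfl

/-- `h_s` is diagonal on the PBW basis, with eigenvalue `λ_s + ⟨rootSum n, α_s^∨⟩` depending only
on the `X`-degree. [folklore] -/
lemma lieH_vermaBasis (lam : b.support → k) (s : b.support) (n : NegRoot b →₀ ℕ) :
    lieH S lam s (vermaBasis S lam n) = (lam s + xChar b k (rootSum b n) s) • vermaBasis S lam n := by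
  rw [lieH_apply, vermaBasis_apply, lie_h_vermaVec S]

/-! ### The coordinate of the highest weight vector and the maximal submodule -/

/-- The coordinate of `v` along the highest weight vector `v_λ = v_0` in the PBW basis.
[folklore] -/
def hwCoord (lam : b.support → k) : Verma S lam →ₗ[k] k := (vermaBasis S lam).coord 0

/-- `hwCoord v_λ = 1`. [folklore] -/
@[simp] lemma hwCoord_hwv (lam : b.support → k) : hwCoord S lam (hwv S lam) = 1 := by
  rw [hwCoord, hwv_eq_vermaVec_zero, ← vermaBasis_apply, Module.Basis.coord_apply,
    Module.Basis.repr_self, Finsupp.single_eq_same]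

/-- Unfolding of `hwCoord`. [folklore] -/
lemma hwCoord_apply (lam : b.support → k) (v : Verma S lam) :
    hwCoord S lam v = (vermaBasis S lam).repr v 0 := rfl

/-- **The maximal submodule `N(λ) = {v | every U(L)-translate of v has zero v_λ-coordinate}`**
of the Verma module (Humphreys §20.2: the sum of all proper submodules; here defined directly
by the coordinate condition, and proved below to contain every proper submodule). [folklore] -/
def maxSub (lam : b.support → k) : Submodule 𝓤 (Verma S lam) where
  carrier := {v | ∀ u : 𝓤, hwCoord S lam (u • v) = 0}
  zero_mem' := fun u => by rw [smul_zero, map_zero]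
  add_mem' := fun {v w} hv hw u => by rw [smul_add, map_add, hv u, hw u, add_zero]
  smul_mem' := fun c {v} hv u => by rw [← mul_smul]; exact hv (u * c)

/-- Membership in `maxSub`. [folklore] -/
lemma mem_maxSub_iff (lam : b.support → k) (v : Verma S lam) :
    v ∈ maxSub S lam ↔ ∀ u : 𝓤, hwCoord S lam (u • v) = 0 := Iff.rfl

/-- **`v_λ ∉ N(λ)`**, so `N(λ)` is a proper submodule. [folklore] -/
theorem hwv_notMem_maxSub (lam : b.support → k) : hwv S lam ∉ maxSub S lam := fun hmem => by
  have h1 := hmem 1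
  rw [one_smul, hwCoord_hwv] at h1
  exact one_ne_zero h1

/-- `N(λ) ≠ ⊤`. [folklore] -/
theorem maxSub_ne_top (lam : b.support → k) : maxSub S lam ≠ ⊤ := fun htop =>
  hwv_notMem_maxSub S lam (htop ▸ Submodule.mem_top)

omit [Fintype ι] [DecidableEq ι] in
/-- A `U(L)`-submodule containing `v_λ` is everything (`v_λ` generates `M(λ)`). [folklore] -/
theorem eq_top_of_hwv_mem (lam : b.support → k) {W : Submodule 𝓤 (Verma S lam)}
    (hW : hwv S lam ∈ W) : W = ⊤ := by
  rw [eq_top_iff]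
  intro v _
  obtain ⟨u, rfl⟩ := exists_smul_hwv_eq S lam v
  exact W.smul_mem u hW

/-- The weight-`0` component (for the `X`-degree) of a vector of `M(λ)` is its `v_λ`-coordinate
times `v_λ` (only `n = 0` has degree `0`). [folklore] -/
lemma proj_zero_eq [P.IsReduced] (lam : b.support → k) (v : Verma S lam) :
    DiagSep.proj (vermaBasis S lam) (rootSum b) 0 v = hwCoord S lam v • hwv S lam := by
  apply (vermaBasis S lam).repr.injective
  ext n
  rw [map_smul, hwv_eq_vermaVec_zero, ← vermaBasis_apply, Module.Basis.repr_self,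
    Finsupp.smul_apply, smul_eq_mul, hwCoord_apply]
  by_cases hn : n = 0
  · subst hn
    rw [DiagSep.repr_proj_apply_of_eq _ _ _ rootSum_zero, Finsupp.single_eq_same, mul_one]
  · rw [DiagSep.repr_proj_apply_of_ne _ _ _ (fun h0 => hn (rootSum_eq_zero_iff.1 h0)),
      Finsupp.single_eq_of_ne hn, mul_zero]

/-- **Maximality of `N(λ)`: every `U(L)`-submodule not containing `v_λ` is contained in `N(λ)`.**
If `w = u • v ∈ W` had `v_λ`-coordinate `c ≠ 0`, its degree-`0` component `c v_λ` would lie in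
`W` (weight components of `𝔥`-stable subspaces, `DiagSep.proj_mem`, the `h_s` separating the
degrees in characteristic `0`). [folklore] -/
theorem le_maxSub_of_hwv_notMem [CharZero k] [Module.Finite ℤ X] [P.IsReduced]
    (lam : b.support → k) {W : Submodule 𝓤 (Verma S lam)} (hW : hwv S lam ∉ W) :
    W ≤ maxSub S lam := by
  intro v hv u
  by_contra hc
  apply hW
  -- the degree-`0` component of `u • v ∈ W` lies in `W`
  have hmem : DiagSep.proj (vermaBasis S lam) (rootSum b) 0 (u • v) ∈ W.restrictScalars k :=
    DiagSep.proj_mem (vermaBasis S lam) (rootSum b) (lieH S lam)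
      (fun s x => lam s + xChar b k x s) (fun s n => lieH_vermaBasis S lam s n)
      (fun n n' hne => sep_rootSum lam n n' hne) (W.restrictScalars k)
      (fun s x hx => by
        rw [lieH_apply, lie_def]
        exact W.smul_mem _ hx)
      (W.smul_mem u hv) 0
  rw [proj_zero_eq S] at hmem
  have h2 : (hwCoord S lam (u • v))⁻¹ • (hwCoord S lam (u • v) • hwv S lam) ∈ W.restrictScalars k :=
    (W.restrictScalars k).smul_mem _ hmem
  rwa [smul_smul, inv_mul_cancel₀ hc, one_smul] at h2

/-- **Every `U(L)`-submodule of `M(λ)` is either everything or contained in `N(λ)`**; in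
particular `N(λ)` is the unique maximal proper submodule. [folklore] -/
theorem eq_top_or_le_maxSub [CharZero k] [Module.Finite ℤ X] [P.IsReduced] (lam : b.support → k)
    (W : Submodule 𝓤 (Verma S lam)) : W = ⊤ ∨ W ≤ maxSub S lam := by
  by_cases hW : hwv S lam ∈ W
  · exact Or.inl (eq_top_of_hwv_mem S lam hW)
  · exact Or.inr (le_maxSub_of_hwv_notMem S lam hW)

/-- `N(λ)` is a coatom of the lattice of `U(L)`-submodules of `M(λ)`. [folklore] -/
theorem isCoatom_maxSub [CharZero k] [Module.Finite ℤ X] [P.IsReduced] (lam : b.support → k) :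
    IsCoatom (maxSub S lam) := by
  refine ⟨maxSub_ne_top S lam, fun W hW => ?_⟩
  rcases eq_top_or_le_maxSub S lam W with h | h
  · exact h
  · exact absurd (lt_of_lt_of_le hW h) (lt_irrefl _)

/-! ### Weight spaces of `M(λ)` for the `X`-degree and the homogeneity of `e_α` -/

/-- The `X`-degree-`x` part `M(λ)_x = span {v_n | rootSum n = x}` of the Verma module (the weight
space of weight `λ + x`). [folklore] -/
def wsp (lam : b.support → k) (x : X) : Submodule k (Verma S lam) :=
  Submodule.span k (vermaBasis S lam '' {n | rootSum b n = x})

/-- **Membership in a weight space through coordinates.** [folklore] -/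
theorem mem_wsp_iff (lam : b.support → k) (x : X) (v : Verma S lam) :
    v ∈ wsp S lam x ↔ ∀ n, (vermaBasis S lam).repr v n ≠ 0 → rootSum b n = x := by
  rw [wsp, Module.Basis.mem_span_image]
  exact ⟨fun h n hn => h (Finsupp.mem_support_iff.2 hn), fun h n hn => h n (Finsupp.mem_support_iff.1 hn)⟩

/-- `v_n ∈ M(λ)_{rootSum n}`. [folklore] -/
lemma vermaVec_mem_wsp (lam : b.support → k) (n : NegRoot b →₀ ℕ) :
    vermaVec S lam n ∈ wsp S lam (rootSum b n) :=
  Submodule.subset_span ⟨n, rfl, vermaBasis_apply S lam n⟩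

/-- `v_λ ∈ M(λ)_0`. [folklore] -/
lemma hwv_mem_wsp (lam : b.support → k) : hwv S lam ∈ wsp S lam 0 := by
  rw [hwv_eq_vermaVec_zero, ← rootSum_zero (b := b)]
  exact vermaVec_mem_wsp S lam 0

/-- **`h_s` acts on `M(λ)_x` by the scalar `λ_s + ⟨x, α_s^∨⟩`.** [folklore] -/
theorem lie_h_of_mem_wsp (lam : b.support → k) {x : X} {v : Verma S lam} (hv : v ∈ wsp S lam x)
    (s : b.support) : ⁅h s, v⁆ = (lam s + xChar b k x s) • v := by
  rw [wsp] at hv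
  induction hv using Submodule.span_induction with
  | mem w hw =>
    obtain ⟨n, hn, rfl⟩ := hw
    rw [← lieH_apply, lieH_vermaBasis S, hn]
  | zero => rw [lie_zero, smul_zero]
  | add v w _ _ hv hw => rw [lie_add, hv, hw, smul_add]
  | smul c v _ hv => rw [lie_smul, hv, smul_comm]

/-- **A simultaneous `𝔥`-eigenvector with the character of degree `x` lies in `M(λ)_x`**
(characteristic `0`: characters separate degrees). [folklore] -/
theorem mem_wsp_of_lie_h_eq [CharZero k] [Module.Finite ℤ X] (lam : b.support → k) {x : X}
    (hx : x ∈ P.rootSpan ℤ) {v : Verma S lam} (hv : ∀ s, ⁅h s, v⁆ = (lam s + xChar b k x s) • v) :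
    v ∈ wsp S lam x := by
  rw [mem_wsp_iff]
  intro n hn
  by_contra hne
  refine hn (DiagSep.repr_eq_zero_of_eigen (vermaBasis S lam) (rootSum b) (lieH S lam)
    (fun s x => lam s + xChar b k x s) (fun s n => lieH_vermaBasis S lam s n)
    (fun s => by rw [lieH_apply, hv s]) (i := n) fun heq => hne ?_)
  refine eq_of_xChar_eq (k := k) (b := b) (Submodule.sub_mem _ (rootSum_mem_rootSpan n) hx)
    (funext fun s => ?_)
  exact add_left_cancel (congr_fun heq s)

/-- **`e_α` maps `M(λ)_x` into `M(λ)_{x + α}`.** [folklore] -/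
theorem lie_e_mem_wsp [CharZero k] [Module.Finite ℤ X] (lam : b.support → k) {x : X}
    (hx : x ∈ P.rootSpan ℤ) {v : Verma S lam} (hv : v ∈ wsp S lam x) (i : ι) :
    ⁅e i, v⁆ ∈ wsp S lam (x + P.root i) := by
  refine mem_wsp_of_lie_h_eq S lam (Submodule.add_mem _ hx (Submodule.subset_span (mem_range_self i)))
    fun s => ?_
  rw [leibniz_lie, S.lie_h_e, smul_lie, lie_h_of_mem_wsp S lam hv s, lie_smul, ← add_smul,
    xChar_add, Pi.add_apply, xChar_root]
  ring_nf

/-- `e_α v_n ∈ M(λ)_{rootSum n + α}`. [folklore] -/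
theorem lie_e_vermaVec_mem_wsp [CharZero k] [Module.Finite ℤ X] (lam : b.support → k)
    (i : ι) (n : NegRoot b →₀ ℕ) :
    ⁅e i, vermaVec S lam n⁆ ∈ wsp S lam (rootSum b n + P.root i) :=
  lie_e_mem_wsp S lam (rootSum_mem_rootSpan n) (vermaVec_mem_wsp S lam n) i

/-- `ι(x) • v` for `x ∈ L` and `v ∈ M(λ)_y`: the Cartan part preserves the degree and `e_α` shifts
it by `α`; for a basis vector of `L`. [folklore] -/
theorem basis_smul_mem_wsp [CharZero k] [Module.Finite ℤ X] (lam : b.support → k) {x : X}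
    (hx : x ∈ P.rootSpan ℤ) {v : Verma S lam} (hv : v ∈ wsp S lam x) (j : b.support ⊕ ι) :
    ∃ y ∈ P.rootSpan ℤ, ⁅S.basis j, v⁆ ∈ wsp S lam y := by
  rcases j with s | i
  · refine ⟨x, hx, ?_⟩
    rw [IsChevalleySystem.coe_basis, Sum.elim_inl, lie_h_of_mem_wsp S lam hv s]
    exact Submodule.smul_mem _ _ hv
  · refine ⟨x + P.root i, Submodule.add_mem _ hx (Submodule.subset_span (mem_range_self i)), ?_⟩
    rw [IsChevalleySystem.coe_basis, Sum.elim_inr]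
    exact lie_e_mem_wsp S lam hx hv i

end System

end ChevalleyVerma

end Literature.NumberTheory.Automorphic
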